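import Mathlib
import Literature.Analysis.FluidPDE.SelfSimilar
import Literature.Analysis.FluidPDE.SelfSimilarLiouville
import Literature.Analysis.FluidPDE.AxisymmetricEuler
import Literature.Analysis.FluidPDE.PineauVicolRDSSLeray
import Literature.Analysis.FluidPDE.TypeIAncientMild
import Literature.Analysis.FluidPDE.ChaeWolfRemovingDSSLimit
import Literature.Analysis.FluidPDE.PineauVicolRSSHolds
import Summits.NavierStokesRegularity.NavierStokesRegularity.Theorems.AxisymmetricExtremalityPFoldToAxisymmetricDenseAngleClosure
import HarnessLib

/-!
# Large symmetry order: the compactness step (route `DssFarFieldSlaving`, crux `BlowupTypeIDssProfile`,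
  stmt-NavierStokesRegularity-0155 — SUPPORT; cell pub-ns-dss, theory item T21, landed by the typer
  from the theory seat's kernel-checked sketch HOME/theory/LiouvilleSideSketch.lean v1.4 §5c/§5e)

`m`-fold symmetric Type-I ancient classical solutions with `m → ∞` accumulate on AXISYMMETRIC Type-I
fields.  Precisely (`largeOrderCompactness`): let `(u_j, p_j)` be classical solutions of Navier–Stokes
(`ν = 1`, no force) on `(EuclideanSpace ℝ (Fin 3)) × (−∞,0)` with a common Type-I bound `‖u_j(t,x)‖ ≤ C₀/(‖x‖+√(−t))`, slices
`m_j`-fold symmetric about `e₃` (`u_j(t, R_{2π/m_j} x) = R_{2π/m_j} u_j(t,x)`), `m_j → ∞`, each with a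
witness `‖x_j‖ ≤ 2C₀/ε₀`, `‖u_j(−1,x_j)‖ ≥ ε₀/2`.  Then a subsequence converges locally uniformly on
`t ≤ −1/4` to a continuous `v` which obeys the Type-I bound there, is a bounded weak solution (after
the time shift `t ↦ v(t − 1/4)`), is AXISYMMETRIC on `t ≤ −1/4` (the angles `2π/m_j` generate every
angle in the limit: `⌊θ/(2π/m_j)⌋·2π/m_j → θ`, equicontinuity), and `v(−1, ·) ≢ 0`.  This is the
Chae–Wolf compactness scheme (tree: `ChaeWolf.exists_uniform_lipschitz`, Arzelà–Ascoli
`exists_strictMono_tendsto_of_lipschitzWith`, `isBoundedWeakNSSolutionOn_of_tendsto`) run WITHOUT any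
self-similarity, exactly in the shape of the tree's `PineauVicol2026.exists_limit_rss` with
«self-similar» replaced by «axisymmetric».  Consumed by `…LargeOrderLiouville.lean` (T21: such
solutions with `m ≥ m₀(C₀)` vanish, via KNSS 2009 Thm 5.3).  No number, no threshold is asserted.

Authorship: statement and proof are the theory seat's (planner-pub-ns-dss-theory-g2, sketch v1.4,
sha256[16] of the sketch recorded in HOME/INBOX.md); the typer unfolded the sketch's `def`s into
explicit hypotheses (no definitions in a proof file) and re-pointed the dense-angle helper lemmas to
their tree originals (`PFoldToAxisymmetric.DenseAngleClosure`).

## References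

* D. Chae, J. Wolf, Comm. PDE 42 (2017) = arXiv:1610.09464, §3 (compactness scheme). [ChaeWolf2017RemovingDSS]
* B. Pineau, V. Vicol, arXiv:2607.09619 (2026), proof of Thm 1.4 via Chae–Wolf (p. 6). [PineauVicol2026]
* G. Koch, N. Nadirashvili, G. Seregin, V. Šverák, Acta Math. 203 (2009), §4, Thm 5.3. [KochNadirashviliSereginSverak2009]
-/

set_option linter.dupNamespace false

noncomputable section

namespace Summit.NavierStokesRegularity.NavierStokesRegularity.Theorems.LargeOrderLiouville

open MeasureTheory Set Function Filter Metric
open scoped NNReal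
open Literature.Analysis.FluidPDE
open Summit.NavierStokesRegularity.NavierStokesRegularity.Theorems
open Literature.Analysis.FluidPDE.PineauVicol2026
open scoped Topology Laplacian ContDiff

/-- T21 step (1): parabolic rescaling preserves `m`-fold symmetry of the slices (so the Chae–Wolf
witness can be moved to the slice `t = −1` by a CONTINUOUS rescaling — no self-similarity needed).
[folklore] -/
theorem mFold_nsRescale {m : ℕ} {u : ℝ → (EuclideanSpace ℝ (Fin 3)) → (EuclideanSpace ℝ (Fin 3))}
    (h : (∀ t < 0, ∀ x : (EuclideanSpace ℝ (Fin 3)), u t (rotZ (2 * Real.pi / m) x) = rotZ (2 * Real.pi / m) (u t x))) {l : ℝ}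
    (hl : 0 < l) : (∀ t < 0, ∀ x : (EuclideanSpace ℝ (Fin 3)), (nsRescale l u) t (rotZ (2 * Real.pi / m) x) = rotZ (2 * Real.pi / m) ((nsRescale l u) t x)) := by
  intro t ht x
  rw [nsRescale_apply, nsRescale_apply]
  have hlt : l ^ 2 * t < 0 := mul_neg_of_pos_of_neg (by positivity) ht
  have e1 : l • rotZ (2 * Real.pi / m) x = rotZ (2 * Real.pi / m) (l • x) := by
    rw [← rotZLIE_apply, ← rotZLIE_apply, LinearIsometryEquiv.map_smul]
  rw [e1, h _ hlt, ← rotZLIE_apply, ← rotZLIE_apply, LinearIsometryEquiv.map_smul]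

/-- T21 step (4): the KNSS 2009 Thm 5.3 hypothesis `|x'| ‖v(t,x)‖ ≤ C₀` from the Type-I decay
(`|x'| ≤ ‖x‖ ≤ ‖x‖ + √(−t)`); apply it to the time-shifted limit `t ↦ v(t − 1/4)`. -/
theorem cylRadius_mul_norm_le_of_le {C₀ : ℝ} {a x : (EuclideanSpace ℝ (Fin 3))} {t : ℝ} (ht : t < 0)
    (h : ‖a‖ ≤ C₀ / (‖x‖ + Real.sqrt (-t))) : cylRadius x * ‖a‖ ≤ C₀ := by
  have hr : cylRadius x ≤ ‖x‖ := by
    rw [cylRadius, EuclideanSpace.norm_eq]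
    apply Real.sqrt_le_sqrt
    simp only [Fin.sum_univ_three, Real.norm_eq_abs, sq_abs]
    nlinarith [sq_nonneg (x 2)]
  have hs : 0 < Real.sqrt (-t) := Real.sqrt_pos.2 (by linarith)
  have hden : 0 < ‖x‖ + Real.sqrt (-t) := by positivity
  calc cylRadius x * ‖a‖
      ≤ (‖x‖ + Real.sqrt (-t)) * (C₀ / (‖x‖ + Real.sqrt (-t))) :=
        mul_le_mul (hr.trans (le_add_of_nonneg_right hs.le)) h (norm_nonneg _) hden.le
    _ = C₀ := by field_simp

/-- The KNSS Thm 5.3 hypothesis `|x'| ‖v(t,x)‖ ≤ C₀` from a Type-I bound `HasTypeIDecay C₀ v`.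
[folklore] -/
theorem cylRadius_mul_norm_le_of_hasTypeIDecay {C₀ : ℝ} {v : ℝ → (EuclideanSpace ℝ (Fin 3)) → (EuclideanSpace ℝ (Fin 3))}
    (hv : HasTypeIDecay C₀ v) {t : ℝ} (ht : t < 0) (x : (EuclideanSpace ℝ (Fin 3))) : cylRadius x * ‖v t x‖ ≤ C₀ :=
  cylRadius_mul_norm_le_of_le ht (hv t ht x)

/-- Elementary algebra behind "the twist is not used": an axisymmetric field which is `(c, R)`-RDSS
with `R` a rotation about the SAME axis is plain `c`-DSS. -/
theorem IsRotatedDSS.isDiscretelySelfSimilar_of_axisymmetric {c θ : ℝ} {u : ℝ → (EuclideanSpace ℝ (Fin 3)) → (EuclideanSpace ℝ (Fin 3))}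
    (h : IsRotatedDSS c (rotZLIE θ) u) (hax : ∀ t, IsAxisymmetric (u t)) :
    IsDiscretelySelfSimilar c u := by
  rw [← isRotatedDSS_refl_iff]
  intro t x
  have key := h t x
  have e1 : u (c ^ 2 * t) (c • rotZLIE θ x) = rotZLIE θ (u (c ^ 2 * t) (c • x)) := by
    rw [← LinearIsometryEquiv.map_smul, rotZLIE_apply, rotZLIE_apply]
    exact hax _ θ _
  rw [e1, LinearIsometryEquiv.symm_apply_apply] at key
  exact key

/-- The orbit map `θ ↦ R_θ z` is continuous (private copy, light imports). -/
private theorem continuous_rotZ_angle'' (z : (EuclideanSpace ℝ (Fin 3))) : Continuous fun θ : ℝ => rotZ θ z := by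
  unfold rotZ
  refine (PiLp.continuous_toLp 2 _).comp ?_
  refine continuous_pi fun i => ?_
  have hc : Continuous fun θ : ℝ => Real.cos θ := Real.continuous_cos
  have hs : Continuous fun θ : ℝ => Real.sin θ := Real.continuous_sin
  fin_cases i
  · exact ((hc.mul (continuous_const (y := z 0))).sub
      (hs.mul (continuous_const (y := z 1)))).congr fun θ => by simp
  · exact ((hs.mul (continuous_const (y := z 0))).add
      (hc.mul (continuous_const (y := z 1)))).congr fun θ => by simp
  · exact (continuous_const (y := z 2)).congr fun θ => by simp

/-- Rotations along a convergent sequence of angles: `θ_n → θ`, `z_n → z₀` imply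
`R_{θ_n} z_n → R_θ z₀`. -/
theorem tendsto_rotZ_of_tendsto' {θ : ℕ → ℝ} {θ₀ : ℝ} {z : ℕ → (EuclideanSpace ℝ (Fin 3))} {z₀ : (EuclideanSpace ℝ (Fin 3))}
    (hθ : Tendsto θ atTop (𝓝 θ₀)) (hz : Tendsto z atTop (𝓝 z₀)) :
    Tendsto (fun n => rotZ (θ n) (z n)) atTop (𝓝 (rotZ θ₀ z₀)) := by
  have h1 : Tendsto (fun n => θ n - θ₀) atTop (𝓝 0) := by
    simpa using hθ.sub_const θ₀
  have h2 := tendsto_rotZ_of_tendsto h1 hz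
  have h3 : Tendsto (fun n => rotZ θ₀ (rotZ (θ n - θ₀) (z n))) atTop (𝓝 (rotZ θ₀ z₀)) := by
    have hc : Continuous (rotZ θ₀ : (EuclideanSpace ℝ (Fin 3)) → (EuclideanSpace ℝ (Fin 3))) := by
      have : (rotZ θ₀ : (EuclideanSpace ℝ (Fin 3)) → (EuclideanSpace ℝ (Fin 3))) = rotZL θ₀ := by funext x; rw [rotZL_apply]
      rw [this]; exact (rotZL θ₀).continuous
    exact (hc.tendsto _).comp h2
  refine h3.congr fun n => ?_
  rw [← rotZ_add]; congr 1; ring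

/-- **`largeOrderCompactness`** (theory T21, compactness half): see the module docstring.
[cite: ChaeWolf2017RemovingDSS, §3 (arXiv:1610.09464 pp. 8–9)] -/
theorem largeOrderCompactness :
    ∀ (C₀ ε₀ : ℝ), 0 < C₀ → 0 < ε₀ → ∀ (m : ℕ → ℕ) (u : ℕ → ℝ → (EuclideanSpace ℝ (Fin 3)) → (EuclideanSpace ℝ (Fin 3))) (p : ℕ → ℝ → (EuclideanSpace ℝ (Fin 3)) → ℝ),
    Tendsto m atTop atTop → (∀ j, IsClassicalNSSolutionOn (Iio 0) 1 0 (u j) (p j)) →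
    (∀ j, HasTypeIDecay C₀ (u j)) →
    (∀ j, ∀ t < 0, ∀ x : (EuclideanSpace ℝ (Fin 3)), u j t (rotZ (2 * Real.pi / m j) x) = rotZ (2 * Real.pi / m j) (u j t x)) →
    (∀ j, ∃ x : (EuclideanSpace ℝ (Fin 3)), ‖x‖ ≤ 2 * C₀ / ε₀ ∧ ε₀ / 2 ≤ ‖u j (-1) x‖) →
    ∃ v : ℝ → (EuclideanSpace ℝ (Fin 3)) → (EuclideanSpace ℝ (Fin 3)), Continuous (uncurry v) ∧
      (∀ t ≤ -(1 / 4 : ℝ), ∀ x, ‖v t x‖ ≤ C₀ / (‖x‖ + Real.sqrt (-t))) ∧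
      IsBoundedWeakNSSolutionOn (Iio 0) isOpen_Iio 1 (fun t => v (t - 1 / 4)) ∧
      (∀ t ≤ -(1 / 4 : ℝ), IsAxisymmetric (v t)) ∧ ∃ x : (EuclideanSpace ℝ (Fin 3)), v (-1) x ≠ 0 := by
  intro C₀ ε₀ hC₀ hε₀ m u p htend hcl hI hsym hwit
  obtain ⟨K, L, hK, hL, hKL⟩ := ChaeWolf.exists_uniform_lipschitz hC₀.le
  -- the equi-Lipschitz family on `ℝ × (EuclideanSpace ℝ (Fin 3))` (fields frozen at time `-1/4` for later times)
  set Kx : ℝ≥0 := (K + L).toNNReal with hKx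
  have hKx' : (Kx : ℝ) = K + L := by rw [hKx, Real.coe_toNNReal _ (by positivity)]
  set f : ℕ → ℝ × (EuclideanSpace ℝ (Fin 3)) → (EuclideanSpace ℝ (Fin 3)) := fun n q => u n (min q.1 (-(1 / 4 : ℝ))) q.2 with hf
  have hf_of_le : ∀ n {t : ℝ} (_ : t ≤ -(1 / 4 : ℝ)) (x : (EuclideanSpace ℝ (Fin 3))), f n (t, x) = u n t x :=
    fun n t ht x => by simp only [hf, min_eq_left ht]
  have hlip : ∀ n, LipschitzWith Kx (f n) := by
    intro n
    obtain ⟨hsp, htm⟩ := hKL (hcl n) (hI n)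
    refine LipschitzWith.of_dist_le_mul fun q q' => ?_
    rw [hKx', dist_eq_norm, Prod.dist_eq, Real.dist_eq, dist_eq_norm]
    have hm : min q.1 (-(1 / 4 : ℝ)) ≤ -(1 / 4 : ℝ) := min_le_right _ _
    have hm' : min q'.1 (-(1 / 4 : ℝ)) ≤ -(1 / 4 : ℝ) := min_le_right _ _
    have hmin : |min q.1 (-(1 / 4 : ℝ)) - min q'.1 (-(1 / 4 : ℝ))| ≤ |q.1 - q'.1| := by
      refine (abs_min_sub_min_le_max _ _ _ _).trans (max_le le_rfl ?_)
      rw [sub_self, abs_zero]; exact abs_nonneg _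
    calc ‖u n (min q.1 (-(1 / 4))) q.2 - u n (min q'.1 (-(1 / 4))) q'.2‖
        ≤ ‖u n (min q.1 (-(1 / 4))) q.2 - u n (min q.1 (-(1 / 4))) q'.2‖ +
            ‖u n (min q.1 (-(1 / 4))) q'.2 - u n (min q'.1 (-(1 / 4))) q'.2‖ :=
          norm_sub_le_norm_sub_add_norm_sub _ _ _
      _ ≤ K * ‖q.2 - q'.2‖ + L * |min q.1 (-(1 / 4 : ℝ)) - min q'.1 (-(1 / 4 : ℝ))| :=
          add_le_add (hsp _ hm _ _) (htm _ hm' _ hm _)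
      _ ≤ K * max |q.1 - q'.1| ‖q.2 - q'.2‖ + L * max |q.1 - q'.1| ‖q.2 - q'.2‖ := by
          gcongr
          · exact le_max_right _ _
          · exact hmin.trans (le_max_left _ _)
      _ = (K + L) * max |q.1 - q'.1| ‖q.2 - q'.2‖ := by ring
  have hball : ∀ n q, f n q ∈ closedBall (0 : (EuclideanSpace ℝ (Fin 3))) (2 * C₀) := fun n q => by
    rw [mem_closedBall, dist_zero_right]
    exact ChaeWolf.typeI_norm_le_two_mul hC₀.le (hI n) (min_le_right _ _) _
  obtain ⟨φ, l, hφ, hl, -, hlim⟩ := exists_strictMono_tendsto_of_lipschitzWith f hlip hball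
  -- the limit field
  set v : ℝ → (EuclideanSpace ℝ (Fin 3)) → (EuclideanSpace ℝ (Fin 3)) := fun t x => l (t, x) with hv
  have hlimv : ∀ {t : ℝ} (_ : t ≤ -(1 / 4 : ℝ)) (x : (EuclideanSpace ℝ (Fin 3))),
      Tendsto (fun n => u (φ n) t x) atTop (𝓝 (v t x)) := by
    intro t ht x
    simpa only [hf_of_le _ ht] using hlim (t, x)
  have hvc : Continuous (uncurry v) := by
    have e : uncurry v = l := by funext q; rfl
    rw [e]; exact hl.continuous
  refine ⟨v, hvc, ?_, ?_, ?_, ?_⟩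
  · -- the Type I bound passes to the limit
    intro t ht x
    exact le_of_tendsto' (hlimv ht x).norm fun n => hI (φ n) t (by linarith) x
  · -- bounded weak solution on `(-∞, -1/4)`, shifted to `(-∞, 0)`
    have hA' : Tendsto (fun k : ℕ => -(k : ℝ) + -1) atTop atBot :=
      (tendsto_neg_atTop_atBot.comp tendsto_natCast_atTop_atTop).atBot_add tendsto_const_nhds
    have e14 : ∀ t : ℝ, t - 1 / 4 = t + -(1 / 4 : ℝ) := fun t => by ring
    have hV : ∀ k : ℕ, IsBoundedWeakNSSolutionOn (Ioo (-(k : ℝ) + -1) 0) isOpen_Ioo 1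
        (fun t => u (φ k) (t - 1 / 4)) := by
      intro k
      have hcl' : IsClassicalNSSolutionOn (Ioo (-(k : ℝ) + -1 + -(1 / 4)) (-(1 / 4))) 1 0
          (u (φ k)) (p (φ k)) :=
        (hcl (φ k)).mono (fun t ht => by simp only [mem_Iio]; linarith [ht.2])
          (uniqueDiffOn_Ioo _ _)
      have hbdd : IsBoundedOn (Ioo (-(k : ℝ) + -1 + -(1 / 4)) (-(1 / 4))) (u (φ k)) :=
        ⟨2 * C₀, fun t ht x => ChaeWolf.typeI_norm_le_two_mul hC₀.le (hI (φ k)) ht.2.le x⟩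
      have h := (hcl'.isBoundedWeakNSSolutionOn hbdd).comp_add_right (-(1 / 4 : ℝ))
        (J := Ioo (-(k : ℝ) + -1) 0) isOpen_Ioo fun t => by
          simp only [mem_Ioo]
          constructor <;> intro h <;> constructor <;> linarith [h.1, h.2]
      simpa only [e14] using h
    have hcont : ∀ k : ℕ, ContinuousOn (uncurry fun t => u (φ k) (t - 1 / 4))
        (Ioo (-(k : ℝ) + -1) 0 ×ˢ univ) := by
      intro k
      have h1 := ((hcl (φ k)).smooth_velocity.comp_add_right (-(1 / 4 : ℝ))).continuousOn
      refine (h1.mono (prod_mono (fun t ht => ?_) Subset.rfl)).congr fun q _ => by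
        simp only [uncurry, e14]
      simp only [mem_preimage, mem_Iio]
      linarith [ht.2]
    have hbd : ∀ k : ℕ, ∀ t ∈ Ioo (-(k : ℝ) + -1) 0, ∀ x,
        ‖u (φ k) (t - 1 / 4) x‖ ≤ 2 * C₀ :=
      fun k t ht x => ChaeWolf.typeI_norm_le_two_mul hC₀.le (hI (φ k)) (by linarith [ht.2]) x
    have hvc' : Continuous (uncurry fun t x => v (t - 1 / 4) x) :=
      hvc.comp ((continuous_fst.sub continuous_const).prodMk continuous_snd)
    exact isBoundedWeakNSSolutionOn_of_tendsto hA' hV hcont hbd hvc'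
      fun t ht x => hlimv (by linarith) x
  · -- axisymmetry of the limit: the symmetry angles `2π/m_j` generate every angle as `m_j → ∞`
    -- first for nonnegative angles
    have key : ∀ t ≤ -(1 / 4 : ℝ), ∀ θ : ℝ, 0 ≤ θ → ∀ x : (EuclideanSpace ℝ (Fin 3)), v t (rotZ θ x) = rotZ θ (v t x) := by
      intro t ht θ hθ x
      have ht0 : t < 0 := by linarith
      set ϑ : ℕ → ℝ := fun j => (⌊θ / (2 * Real.pi / m (φ j))⌋₊ : ℝ) * (2 * Real.pi / m (φ j))
        with hϑ
      have hϑlim : Tendsto ϑ atTop (𝓝 θ) :=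
        PFoldToAxisymmetric.DenseAngleClosure.tendsto_floor_mul_angle (htend.comp hφ.tendsto_atTop) hθ
      -- equivariance along the sequence
      have heq : ∀ j, u (φ j) t (rotZ (ϑ j) x) = rotZ (ϑ j) (u (φ j) t x) := fun j =>
        PFoldToAxisymmetric.DenseAngleClosure.equivariant_nat_mul (fun y => hsym (φ j) t ht0 y) _ x
      -- left side converges to `v t (R_θ x)` by equicontinuity
      have hq : Tendsto (fun j => ((t, rotZ (ϑ j) x) : ℝ × (EuclideanSpace ℝ (Fin 3)))) atTop (𝓝 (t, rotZ θ x)) :=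
        tendsto_const_nhds.prodMk_nhds (((continuous_rotZ_angle'' x).tendsto θ).comp hϑlim)
      have h1 : Tendsto (fun j => f (φ j) (t, rotZ (ϑ j) x)) atTop (𝓝 (v t (rotZ θ x))) :=
        ChaeWolf.tendsto_apply_of_tendsto (fun n => hlip (φ n)) hq (hlim (t, rotZ θ x))
      have h1' : Tendsto (fun j => u (φ j) t (rotZ (ϑ j) x)) atTop (𝓝 (v t (rotZ θ x))) := by
        refine h1.congr fun j => ?_
        simp only [hf_of_le _ ht]
      -- right side converges to `R_θ (v t x)`
      have h2 : Tendsto (fun j => rotZ (ϑ j) (u (φ j) t x)) atTop (𝓝 (rotZ θ (v t x))) :=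
        tendsto_rotZ_of_tendsto' hϑlim (hlimv ht x)
      exact tendsto_nhds_unique (h1'.congr fun j => heq j) h2
    -- then for every angle, by `2π`-periodicity
    intro t ht θ x
    obtain ⟨n, hn⟩ : ∃ n : ℕ, 0 ≤ θ + n * (2 * Real.pi) := by
      obtain ⟨n, hn⟩ := exists_nat_ge (-θ / (2 * Real.pi))
      refine ⟨n, ?_⟩
      rw [div_le_iff₀ (by positivity)] at hn
      linarith
    have hper : rotZ (θ + n * (2 * Real.pi)) = rotZ θ := by
      funext y
      simp only [rotZ, Real.cos_add_nat_mul_two_pi, Real.sin_add_nat_mul_two_pi]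
    have h := key t ht (θ + n * (2 * Real.pi)) hn x
    rwa [hper] at h
  · -- nontriviality at time `-1`
    choose y hyb hyw using hwit
    have hSc : IsCompact (closedBall (0 : (EuclideanSpace ℝ (Fin 3))) (2 * C₀ / ε₀)) := isCompact_closedBall _ _
    have hmemS : ∀ n, y (φ n) ∈ closedBall (0 : (EuclideanSpace ℝ (Fin 3))) (2 * C₀ / ε₀) := fun n => by
      rw [mem_closedBall, dist_zero_right]; exact hyb (φ n)
    obtain ⟨ybar, -, ψ, hψ, hconv⟩ := hSc.tendsto_subseq hmemS
    refine ⟨ybar, fun h0 => ?_⟩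
    have h14 : (-1 : ℝ) ≤ -(1 / 4 : ℝ) := by norm_num
    have hy0 : Tendsto (fun n => f (φ (ψ n)) ((-1 : ℝ), ybar)) atTop (𝓝 (v (-1) ybar)) :=
      (hlim ((-1 : ℝ), ybar)).comp hψ.tendsto_atTop
    have hconv' : Tendsto (fun n => ((-1 : ℝ), y (φ (ψ n)))) atTop (𝓝 ((-1 : ℝ), ybar)) :=
      tendsto_const_nhds.prodMk_nhds hconv
    have hmain := ChaeWolf.tendsto_apply_of_tendsto (fun n => hlip (φ (ψ n))) hconv' hy0
    have hge : ε₀ / 2 ≤ ‖v (-1) ybar‖ := by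
      refine ge_of_tendsto' hmain.norm fun n => ?_
      simp only [hf_of_le _ h14]
      exact hyw (φ (ψ n))
    rw [h0, norm_zero] at hge
    linarith

end Summit.NavierStokesRegularity.NavierStokesRegularity.Theorems.LargeOrderLiouville

end
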